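import Literature.Barriers.RiemannHypothesis.TuranMinWitnessTables
import Mathlib.Analysis.SpecialFunctions.Log.Deriv
import Mathlib.Analysis.SpecificLimits.Basic
import HarnessLib

/-!
# Certified evaluation of `T(72 204 113 780 255)`: logarithms and the chained harmonic table

Barrier catalogue `Literature/Barriers/RiemannHypothesis/`, support file for the discharge of
`Literature.Barriers.RiemannHypothesis.BFM2008_thm1_minWitness`. Specifications of the "log layer"
of the evaluator `TuranMinWitnessCalc.lean`:

* `mem_logRatio` — `logRatio a b ∋ log((2a+1)/(2b+1))` (the `artanh` series
  `log(1+x) = ∑ 2/(2k+1) (x/(x+2))^{2k+1}`, Mathlib's `Real.hasSum_log_one_add`, with the geometric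
  tail bound `≤ 2v^{2J+1}/(1−v²)`);
* `corr_bounds` / `mem_corrEncl` — for `c_m = log((2m+1)/(2m−1)) − 1/m`:
  `1/(12m³) ≤ c_m ≤ 1/(12m³) + 1/(60m⁵)` and
  `∑_{b<m≤a} c_m ∈ [((b+1)⁻²−(a+1)⁻²)/24, (b⁻²−a⁻²)/24 + b⁻⁴/240]`;
* `Hn_eq_log_sub_corr` — `H(a) − H(b) = log((2a+1)/(2b+1)) − ∑_{b<m≤a} c_m`;
* `mem_harmonicMI`, `hlogChain_spec`, `hlogTab_spec` — the chained table satisfies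
  `hlog[e] ≤ 2^57 H(⌊N/e⌋) < hlog[e] + β + 1` on its range.

## References

* [BorweinFergusonMossinghoff2008] P. Borwein, R. Ferguson, M. J. Mossinghoff, Math. Comp. 77
  (2008), 1681–1694, Thm. 1.
-/

open Finset Real
open Literature.Analysis.ValidatedNumerics.NumericsMP
open Literature.Analysis.ValidatedNumerics (Numerics.cdiv Numerics.fdiv_le_div Numerics.div_le_cdiv)

namespace Literature.Barriers.RiemannHypothesis.TuranMinWitness

/-- The scale `SL = 2^90` is positive. [folklore] -/
theorem SL_pos : 0 < SL := by unfold SL; positivity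

/-! ## The `artanh` series -/

/-- The terms of the series `log((1+v)/(1−v)) = ∑ 2/(2k+1) v^{2k+1}`. [folklore] -/
noncomputable def aterm (v : ℝ) (k : ℕ) : ℝ := (2 : ℝ) * (1 / (2 * k + 1)) * v ^ (2 * k + 1)

/-- Partial sums of the series. [folklore] -/
noncomputable def apsum (v : ℝ) (J : ℕ) : ℝ := ∑ k ∈ range J, aterm v k

/-- For `r = (2a+1)/(2b+1)` with `b ≤ a`: `log r = ∑ aterm v`, `v = (a−b)/(a+b+1)`. [folklore] -/
theorem hasSum_aterm_logRatio {a b : ℕ} (hab : b ≤ a) :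
    HasSum (aterm (((a : ℝ) - b) / (a + b + 1))) (Real.log ((2 * a + 1) / (2 * b + 1))) := by
  have hb : (0 : ℝ) < 2 * b + 1 := by positivity
  set x : ℝ := (2 * a + 1) / (2 * b + 1) - 1 with hx
  have hx0 : 0 ≤ x := by
    rw [hx, sub_nonneg, le_div_iff₀ hb]
    have : (b : ℝ) ≤ a := by exact_mod_cast hab
    linarith
  have h := Real.hasSum_log_one_add hx0
  have e1 : 1 + x = (2 * a + 1) / (2 * b + 1) := by rw [hx]; ring
  have hx1 : x = 2 * ((a : ℝ) - b) / (2 * b + 1) := by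
    rw [hx, div_sub_one hb.ne']; congr 1; ring
  have hx2 : x + 2 = 2 * ((a : ℝ) + b + 1) / (2 * b + 1) := by
    rw [hx1, div_add' _ _ _ hb.ne']; congr 1; ring
  have e2 : x / (x + 2) = ((a : ℝ) - b) / (a + b + 1) := by
    rw [hx2, hx1, div_div_div_cancel_right₀ hb.ne', mul_div_mul_left _ _ two_ne_zero]
  rw [e1] at h
  convert h using 1
  ext k
  rw [aterm, e2]

/-- The terms are nonnegative for `v ≥ 0`. [folklore] -/
theorem aterm_nonneg {v : ℝ} (hv : 0 ≤ v) (k : ℕ) : 0 ≤ aterm v k := by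
  unfold aterm; positivity

/-- **Two-sided truncation bound**: for `0 ≤ v ≤ 1/2` and `HasSum (aterm v) s`,
`apsum v J ≤ s ≤ apsum v J + (8/3) v^{2J+1}`. [folklore] -/
theorem apsum_le_and_le {v s : ℝ} (hv0 : 0 ≤ v) (hv1 : v ≤ 1 / 2) (hs : HasSum (aterm v) s)
    (J : ℕ) : apsum v J ≤ s ∧ s ≤ apsum v J + 8 / 3 * v ^ (2 * J + 1) := by
  constructor
  · exact sum_le_hasSum (range J) (fun k _ => aterm_nonneg hv0 k) hs
  · -- tail: `∑_{k ≥ J} aterm v k ≤ ∑_n 2 v^{2J+1} (v²)^n = 2 v^{2J+1} / (1 - v²)`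
    have htail : HasSum (fun n => aterm v (n + J)) (s - apsum v J) := (hasSum_nat_add_iff' J).2 hs
    have hv2 : v ^ 2 < 1 := by nlinarith
    have hgeom : HasSum (fun n : ℕ => 2 * v ^ (2 * J + 1) * (v ^ 2) ^ n)
        (2 * v ^ (2 * J + 1) * (1 - v ^ 2)⁻¹) :=
      (hasSum_geometric_of_lt_one (by positivity) hv2).mul_left _
    have hle : ∀ n, aterm v (n + J) ≤ 2 * v ^ (2 * J + 1) * (v ^ 2) ^ n := by
      intro n
      unfold aterm
      have h1 : (1 : ℝ) / (2 * (n + J : ℕ) + 1) ≤ 1 := by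
        rw [div_le_one (by positivity)]
        have : (0 : ℝ) ≤ (n + J : ℕ) := by positivity
        linarith
      have h2 : v ^ (2 * (n + J) + 1) = v ^ (2 * J + 1) * (v ^ 2) ^ n := by
        rw [← pow_mul, ← pow_add]; ring_nf
      rw [h2]
      have h3 : 0 ≤ v ^ (2 * J + 1) * (v ^ 2) ^ n := by positivity
      nlinarith
    have h := hasSum_le hle htail hgeom
    have h4 : (1 - v ^ 2)⁻¹ ≤ 4 / 3 := by
      rw [inv_le_comm₀ (by nlinarith) (by norm_num)]
      nlinarith
    have h5 : 0 ≤ v ^ (2 * J + 1) := by positivity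
    nlinarith

/-! ## `atanhLoop` and `logRatio` -/

/-- Invariant of `atanhLoop`: started from `pow ∋ v^{2j+1}`, `sum ∋ apsum v j`, it returns
`(sum', pow')` with `sum' ∋ apsum v J`, `pow' ∋ v^{2J+1}` for some `J`. [folklore] -/
theorem atanhLoop_spec {v : ℝ} {V2 : MI} (hV2 : MI.mem SL (v ^ 2) V2) :
    ∀ (fuel j : ℕ) (pow sum : MI), MI.mem SL (v ^ (2 * j + 1)) pow → MI.mem SL (apsum v j) sum →
      ∃ J, MI.mem SL (apsum v J) (atanhLoop V2 fuel j pow sum).1 ∧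
        MI.mem SL (v ^ (2 * J + 1)) (atanhLoop V2 fuel j pow sum).2
  | 0, j, pow, sum, hp, hs => ⟨j, by simpa [atanhLoop] using hs, by simpa [atanhLoop] using hp⟩
  | fuel + 1, j, pow, sum, hp, hs => by
    simp only [atanhLoop]
    have hs' : MI.mem SL (apsum v (j + 1)) (sum.add ((pow.divNat (2 * j + 1)).mulInt 2)) := by
      rw [apsum, sum_range_succ, ← apsum]
      refine MI.mem_add hs ?_
      have h1 := MI.mem_mulInt (MI.mem_divNat hp (n := 2 * j + 1) (by omega)) 2
      convert h1 using 1
      rw [aterm]; push_cast; ring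
    have hp' : MI.mem SL (v ^ (2 * (j + 1) + 1)) (pow.mul SL V2) := by
      have := MI.mem_mul SL_pos hp hV2
      convert this using 1; ring
    split_ifs with h
    · exact ⟨j + 1, hs', hp'⟩
    · exact atanhLoop_spec hV2 fuel (j + 1) _ _ hp' hs'

/-- `logRatio a b = some I` forces `b ≤ a ≤ 3b + 1`. [folklore] -/
theorem logRatio_some_iff_le {a b : ℕ} {I : MI} (h : logRatio a b = some I) : b ≤ a ∧ a ≤ 3 * b + 1 := by
  unfold logRatio at h
  split_ifs at h with hc
  exact hc

/-- **`logRatio` encloses the logarithm**: `logRatio a b = some I → log((2a+1)/(2b+1)) ∈ I`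
(scale `2^90`). [folklore] -/
theorem mem_logRatio {a b : ℕ} {I : MI} (h : logRatio a b = some I) :
    MI.mem SL (Real.log ((2 * a + 1) / (2 * b + 1))) I := by
  obtain ⟨hab, ha3⟩ := logRatio_some_iff_le h
  unfold logRatio at h
  rw [if_pos ⟨hab, ha3⟩] at h
  simp only [Option.some.injEq] at h
  set v : ℝ := ((a : ℝ) - b) / (a + b + 1) with hv
  have hv0 : 0 ≤ v := by
    rw [hv]; apply div_nonneg _ (by positivity)
    have : (b : ℝ) ≤ a := by exact_mod_cast hab
    linarith
  have hv1 : v ≤ 1 / 2 := by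
    rw [hv, div_le_iff₀ (by positivity)]
    have : (a : ℝ) ≤ 3 * b + 1 := by exact_mod_cast ha3
    linarith
  have hV : MI.mem SL v (MI.ofFrac SL ((a : ℤ) - b) (a + b + 1)) := by
    have := MI.mem_ofFrac SL ((a : ℤ) - b) (q := a + b + 1) (by omega)
    convert this using 1
    rw [hv]; push_cast; ring
  have hV2 : MI.mem SL (v ^ 2) ((MI.ofFrac SL ((a : ℤ) - b) (a + b + 1)).mul SL
      (MI.ofFrac SL ((a : ℤ) - b) (a + b + 1))) := by
    rw [pow_two]; exact MI.mem_mul SL_pos hV hV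
  obtain ⟨J, hsum, hpow⟩ := atanhLoop_spec hV2 80 0 _ ⟨0, 0⟩ (by simpa using hV)
    (by simp [apsum, MI.mem])
  set r := atanhLoop ((MI.ofFrac SL ((a : ℤ) - b) (a + b + 1)).mul SL
      (MI.ofFrac SL ((a : ℤ) - b) (a + b + 1))) 80 0 (MI.ofFrac SL ((a : ℤ) - b) (a + b + 1)) ⟨0, 0⟩
    with hr
  rw [← h]
  obtain ⟨h1, h2⟩ := apsum_le_and_le hv0 hv1 (hasSum_aterm_logRatio hab) J
  refine MI.mem_widen hsum ?_
  -- `|log r − apsum v J| · S ≤ (8/3) v^{2J+1} S ≤ 3 · pow.hi`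
  have hS : (0 : ℝ) < SL := by exact_mod_cast SL_pos
  have hp : v ^ (2 * J + 1) * SL ≤ (r.2.hi : ℝ) := hpow.2
  have h4 : (Real.log ((2 * a + 1) / (2 * b + 1)) - apsum v J) * SL ≤ 8 / 3 * (v ^ (2 * J + 1) * SL) := by
    have := mul_le_mul_of_nonneg_right h2 hS.le
    nlinarith
  have h5 : (0 : ℝ) ≤ max (r.2.hi : ℝ) 0 := le_max_right _ _
  have h3 : (r.2.hi : ℝ) ≤ max (r.2.hi : ℝ) 0 := le_max_left _ _
  have h6 : 0 ≤ v ^ (2 * J + 1) * SL := by positivity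
  rw [abs_of_nonneg (by linarith)]
  push_cast
  linarith

/-! ## The correction terms `c_m` -/

/-- `c_m = log((2m+1)/(2m−1)) − 1/m`. [folklore] -/
noncomputable def corr (m : ℕ) : ℝ := Real.log ((2 * m + 1) / (2 * m - 1)) - 1 / m

/-- **`1/(12m³) ≤ c_m ≤ 1/(12m³) + 1/(60m⁵)`** for `m ≥ 1` (the series in `u = 1/(2m)`:
`c_m = 2u³/3 + 2u⁵/5 + ⋯`). [folklore] -/
theorem corr_bounds {m : ℕ} (hm : 1 ≤ m) :
    1 / (12 * (m : ℝ) ^ 3) ≤ corr m ∧ corr m ≤ 1 / (12 * (m : ℝ) ^ 3) + 1 / (60 * (m : ℝ) ^ 5) := by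
  have hmr : (1 : ℝ) ≤ m := by exact_mod_cast hm
  have hm0 : (m : ℝ) ≠ 0 := by exact_mod_cast (show m ≠ 0 by omega)
  set u : ℝ := 1 / (2 * m) with hu
  have hu0 : 0 ≤ u := by rw [hu]; positivity
  have hu1 : u ≤ 1 / 2 := by
    rw [hu, div_le_div_iff₀ (by positivity) (by norm_num)]; linarith
  -- the series for `log((2m+1)/(2m-1))` with `a = 2m-1 ≥ 1`, `b = m - 1`… we use `hasSum_log_one_add`
  -- directly: `1 + x = (2m+1)/(2m-1)` with `x = 2/(2m-1)`, `x/(x+2) = 1/(2m) = u`.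
  have hden : (0 : ℝ) < 2 * m - 1 := by linarith
  set x : ℝ := 2 / (2 * m - 1) with hx
  have hx0 : 0 ≤ x := by rw [hx]; positivity
  have hser := Real.hasSum_log_one_add hx0
  have e1 : 1 + x = (2 * m + 1) / (2 * m - 1) := by
    rw [hx]; field_simp; ring
  have e2 : x / (x + 2) = u := by
    rw [hx, hu]; field_simp; ring
  rw [e1, e2] at hser
  have hser' : HasSum (aterm u) (Real.log ((2 * m + 1) / (2 * m - 1))) := hser
  -- `corr m = sum - aterm u 0` and `aterm u 0 = 2u = 1/m`
  have ha0 : aterm u 0 = 1 / m := by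
    rw [aterm, hu]; push_cast; ring
  have ha1 : aterm u 1 = 1 / (12 * (m : ℝ) ^ 3) := by
    rw [aterm, hu]; push_cast; ring
  obtain ⟨hlo, hhi⟩ := apsum_le_and_le hu0 hu1 hser' 2
  have hps : apsum u 2 = aterm u 0 + aterm u 1 := by
    rw [apsum, sum_range_succ, sum_range_succ, sum_range_zero, zero_add]
  rw [hps, ha0, ha1] at hlo hhi
  have hu5 : (8 : ℝ) / 3 * u ^ (2 * 2 + 1) = 1 / (12 * (m : ℝ) ^ 5) := by
    rw [hu]; ring
  rw [hu5] at hhi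
  unfold corr
  have hm5 : (0 : ℝ) < 60 * (m : ℝ) ^ 5 := by positivity
  have hcmp : 1 / (12 * (m : ℝ) ^ 5) ≤ 1 / (60 * (m : ℝ) ^ 5) + 0 ∨ True := Or.inr trivial
  constructor
  · linarith
  · have : (1 : ℝ) / (12 * (m : ℝ) ^ 5) ≤ 1 / (60 * (m : ℝ) ^ 5) * 5 := by
      rw [div_mul_eq_mul_div, div_le_div_iff₀ (by positivity) hm5]; nlinarith
    -- we only have the bound `≤ 1/(12 m⁵)`; sharpen using the true tail `≤ 2u⁵/5 · 4/3 = 1/(60m⁵)`: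
    -- redo the tail estimate with the factor `1/(2k+1) ≤ 1/5` for `k ≥ 2`.
    have htail : HasSum (fun n => aterm u (n + 2)) (Real.log ((2 * m + 1) / (2 * m - 1)) - apsum u 2) :=
      (hasSum_nat_add_iff' 2).2 hser'
    have hv2 : u ^ 2 < 1 := by nlinarith
    have hgeom : HasSum (fun n : ℕ => 2 / 5 * u ^ 5 * (u ^ 2) ^ n) (2 / 5 * u ^ 5 * (1 - u ^ 2)⁻¹) :=
      (hasSum_geometric_of_lt_one (by positivity) hv2).mul_left _
    have hle : ∀ n, aterm u (n + 2) ≤ 2 / 5 * u ^ 5 * (u ^ 2) ^ n := by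
      intro n
      unfold aterm
      have h1 : (1 : ℝ) / (2 * (n + 2 : ℕ) + 1) ≤ 1 / 5 := by
        rw [div_le_div_iff₀ (by positivity) (by norm_num)]
        have : (0 : ℝ) ≤ n := by positivity
        push_cast; linarith
      have h2 : u ^ (2 * (n + 2) + 1) = u ^ 5 * (u ^ 2) ^ n := by
        rw [← pow_mul, ← pow_add]; ring_nf
      rw [h2]
      have h3 : 0 ≤ u ^ 5 * (u ^ 2) ^ n := by positivity
      nlinarith
    have h := hasSum_le hle htail hgeom
    have h4 : (1 - u ^ 2)⁻¹ ≤ 4 / 3 := by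
      rw [inv_le_comm₀ (by nlinarith) (by norm_num)]; nlinarith
    have h6 : (2 : ℝ) / 5 * u ^ 5 * (4 / 3) = 1 / (60 * (m : ℝ) ^ 5) := by
      rw [hu]; ring
    have h7 : 0 ≤ u ^ 5 := by positivity
    rw [hps, ha0, ha1] at h
    nlinarith

/-- Telescoping over `Ioc b a`: `∑_{b<m≤a} (g m − g (m−1)) = g a − g b`. [folklore] -/
theorem sum_Ioc_telescope (g : ℕ → ℝ) {a b : ℕ} (hab : b ≤ a) :
    ∑ m ∈ Ioc b a, (g m - g (m - 1)) = g a - g b := by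
  induction a with
  | zero =>
    have : b = 0 := Nat.le_zero.1 hab
    subst this; simp
  | succ n ih =>
    rcases Nat.lt_or_ge n b with hlt | hge
    · have hb : b = n + 1 := by omega
      subst hb; simp
    · rw [sum_Ioc_succ_top hge, ih hge, Nat.add_sub_cancel]; ring

/-- `∑_{b<m≤a} log((2m+1)/(2m−1)) = log((2a+1)/(2b+1))`. [folklore] -/
theorem sum_Ioc_log_ratio {a b : ℕ} (hab : b ≤ a) :
    ∑ m ∈ Ioc b a, Real.log ((2 * m + 1) / (2 * m - 1)) = Real.log ((2 * a + 1) / (2 * b + 1)) := by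
  have h := sum_Ioc_telescope (fun m : ℕ => Real.log (2 * m + 1)) hab
  rw [← Real.log_div (by positivity) (by positivity)] at h
  rw [← h]
  refine sum_congr rfl fun m hm => ?_
  have hm1 : 1 ≤ m := by have := (mem_Ioc.1 hm).1; omega
  have e : (2 : ℝ) * m - 1 = 2 * ((m - 1 : ℕ) : ℝ) + 1 := by
    rw [Nat.cast_sub hm1]; push_cast; ring
  rw [e, Real.log_div (by positivity) (by positivity)]

/-- **`H(a) − H(b) = log((2a+1)/(2b+1)) − ∑_{b<m≤a} c_m`** for `b ≤ a`. [folklore] -/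
theorem Hn_eq_log_sub_corr {a b : ℕ} (hab : b ≤ a) :
    Hn a - Hn b = Real.log ((2 * a + 1) / (2 * b + 1)) - ∑ m ∈ Ioc b a, corr m := by
  rw [Hn_sub_Hn hab, ← sum_Ioc_log_ratio hab, ← sum_sub_distrib]
  refine sum_congr rfl fun m _ => ?_
  rw [corr]; ring

/-- `∑_{b<m≤a} 1/m³ ≤ (b⁻² − a⁻²)/2` for `1 ≤ b`. [folklore] -/
theorem sum_inv_cube_le {a b : ℕ} (hab : b ≤ a) (hb : 1 ≤ b) :
    ∑ m ∈ Ioc b a, 1 / (m : ℝ) ^ 3 ≤ (1 / (b : ℝ) ^ 2 - 1 / (a : ℝ) ^ 2) / 2 := by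
  have h := sum_Ioc_telescope (fun m : ℕ => -(1 / (m : ℝ) ^ 2) / 2) hab
  have e : (1 / (b : ℝ) ^ 2 - 1 / (a : ℝ) ^ 2) / 2 =
      -(1 / (a : ℝ) ^ 2) / 2 - -(1 / (b : ℝ) ^ 2) / 2 := by ring
  rw [e, ← h]
  refine sum_le_sum fun m hm => ?_
  have hm2 : 2 ≤ m := by have := (mem_Ioc.1 hm).1; omega
  have hmr : (2 : ℝ) ≤ m := by exact_mod_cast hm2
  have hm0 : (m : ℝ) ≠ 0 := by positivity
  have hm1 : (m : ℝ) - 1 ≠ 0 := by linarith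
  have e1 : ((m - 1 : ℕ) : ℝ) = m - 1 := by rw [Nat.cast_sub (by omega)]; push_cast; ring
  rw [e1]
  have e2 : -(1 / (m : ℝ) ^ 2) / 2 - -(1 / ((m : ℝ) - 1) ^ 2) / 2 =
      ((m : ℝ) ^ 2 - (m - 1) ^ 2) / (2 * (m : ℝ) ^ 2 * (m - 1) ^ 2) := by
    field_simp; ring
  rw [e2, div_le_div_iff₀ (by positivity) (by positivity)]
  nlinarith

/-- `((b+1)⁻² − (a+1)⁻²)/2 ≤ ∑_{b<m≤a} 1/m³`. [folklore] -/
theorem le_sum_inv_cube {a b : ℕ} (hab : b ≤ a) :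
    (1 / ((b : ℝ) + 1) ^ 2 - 1 / ((a : ℝ) + 1) ^ 2) / 2 ≤ ∑ m ∈ Ioc b a, 1 / (m : ℝ) ^ 3 := by
  have h := sum_Ioc_telescope (fun m : ℕ => -(1 / ((m : ℝ) + 1) ^ 2) / 2) hab
  have e : (1 / ((b : ℝ) + 1) ^ 2 - 1 / ((a : ℝ) + 1) ^ 2) / 2 =
      -(1 / ((a : ℝ) + 1) ^ 2) / 2 - -(1 / ((b : ℝ) + 1) ^ 2) / 2 := by ring
  rw [e, ← h]
  refine sum_le_sum fun m hm => ?_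
  have hm1 : 1 ≤ m := by have := (mem_Ioc.1 hm).1; omega
  have hmr : (1 : ℝ) ≤ m := by exact_mod_cast hm1
  have hm0 : (m : ℝ) ≠ 0 := by positivity
  have hm1' : (m : ℝ) + 1 ≠ 0 := by positivity
  have e1 : ((m - 1 : ℕ) : ℝ) = m - 1 := by rw [Nat.cast_sub hm1]; push_cast; ring
  rw [e1, sub_add_cancel]
  have e2 : -(1 / ((m : ℝ) + 1) ^ 2) / 2 - -(1 / (m : ℝ) ^ 2) / 2 =
      (((m : ℝ) + 1) ^ 2 - (m : ℝ) ^ 2) / (2 * ((m : ℝ) + 1) ^ 2 * (m : ℝ) ^ 2) := by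
    field_simp; ring
  rw [e2, div_le_div_iff₀ (by positivity) (by positivity)]
  nlinarith

/-- `∑_{b<m≤a} 1/m⁵ ≤ b⁻⁴/4` for `1 ≤ b`. [folklore] -/
theorem sum_inv_pow_five_le {a b : ℕ} (hab : b ≤ a) (hb : 1 ≤ b) :
    ∑ m ∈ Ioc b a, 1 / (m : ℝ) ^ 5 ≤ 1 / (b : ℝ) ^ 4 / 4 := by
  have h := sum_Ioc_telescope (fun m : ℕ => -(1 / (m : ℝ) ^ 4) / 4) hab
  have hbr : (1 : ℝ) ≤ b := by exact_mod_cast hb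
  have e : -(1 / (a : ℝ) ^ 4) / 4 - -(1 / (b : ℝ) ^ 4) / 4 ≤ 1 / (b : ℝ) ^ 4 / 4 := by
    have : 0 ≤ 1 / (a : ℝ) ^ 4 := by positivity
    linarith
  refine le_trans ?_ e
  rw [← h]
  refine sum_le_sum fun m hm => ?_
  have hm2 : 2 ≤ m := by have := (mem_Ioc.1 hm).1; omega
  have hmr : (2 : ℝ) ≤ m := by exact_mod_cast hm2
  have hm0 : (m : ℝ) ≠ 0 := by positivity
  have hm1 : (m : ℝ) - 1 ≠ 0 := by linarith
  have e1 : ((m - 1 : ℕ) : ℝ) = m - 1 := by rw [Nat.cast_sub (by omega)]; push_cast; ring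
  rw [e1]
  have hpos1 : (0 : ℝ) < ((m : ℝ) - 1) ^ 4 := pow_pos (by linarith) 4
  have e2 : -(1 / (m : ℝ) ^ 4) / 4 - -(1 / ((m : ℝ) - 1) ^ 4) / 4 =
      ((m : ℝ) ^ 4 - (m - 1) ^ 4) / (4 * (m : ℝ) ^ 4 * (m - 1) ^ 4) := by
    field_simp; ring
  rw [e2, div_le_div_iff₀ (by positivity) (by positivity)]
  nlinarith [sq_nonneg ((m : ℝ) - 2), mul_nonneg (by linarith : (0:ℝ) ≤ m - 2) (sq_nonneg (m : ℝ)),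
    mul_nonneg (mul_nonneg (by linarith : (0:ℝ) ≤ m - 2) (sq_nonneg (m : ℝ))) (sq_nonneg (m : ℝ))]

/-- **`corrEncl` encloses the correction sum**: for `1 ≤ b ≤ a`,
`∑_{b<m≤a} c_m ∈ corrEncl a b` (scale `2^90`). [folklore] -/
theorem mem_corrEncl {a b : ℕ} (hab : b ≤ a) (hb : 1 ≤ b) :
    MI.mem SL (∑ m ∈ Ioc b a, corr m) (corrEncl a b) := by
  have hbr : (1 : ℝ) ≤ b := by exact_mod_cast hb
  have har : (1 : ℝ) ≤ a := by exact_mod_cast (hb.trans hab)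
  -- lower and upper bounds on the sum
  have hL : (1 / ((b : ℝ) + 1) ^ 2 - 1 / ((a : ℝ) + 1) ^ 2) / 24 ≤ ∑ m ∈ Ioc b a, corr m := by
    have h1 := le_sum_inv_cube hab
    have h2 : ∑ m ∈ Ioc b a, 1 / (12 * (m : ℝ) ^ 3) ≤ ∑ m ∈ Ioc b a, corr m :=
      sum_le_sum fun m hm => (corr_bounds (by have := (mem_Ioc.1 hm).1; omega)).1
    have h3 : ∑ m ∈ Ioc b a, 1 / (12 * (m : ℝ) ^ 3) = (∑ m ∈ Ioc b a, 1 / (m : ℝ) ^ 3) / 12 := by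
      rw [sum_div]; exact sum_congr rfl fun m _ => by ring
    rw [h3] at h2
    linarith
  have hU : ∑ m ∈ Ioc b a, corr m ≤
      (1 / (b : ℝ) ^ 2 - 1 / (a : ℝ) ^ 2) / 24 + 1 / (b : ℝ) ^ 4 / 240 := by
    have h1 := sum_inv_cube_le hab hb
    have h1' := sum_inv_pow_five_le hab hb
    have h2 : ∑ m ∈ Ioc b a, corr m ≤
        ∑ m ∈ Ioc b a, (1 / (12 * (m : ℝ) ^ 3) + 1 / (60 * (m : ℝ) ^ 5)) :=
      sum_le_sum fun m hm => (corr_bounds (by have := (mem_Ioc.1 hm).1; omega)).2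
    have h3 : ∑ m ∈ Ioc b a, (1 / (12 * (m : ℝ) ^ 3) + 1 / (60 * (m : ℝ) ^ 5)) =
        (∑ m ∈ Ioc b a, 1 / (m : ℝ) ^ 3) / 12 + (∑ m ∈ Ioc b a, 1 / (m : ℝ) ^ 5) / 60 := by
      rw [sum_add_distrib, sum_div, sum_div]
      congr 1 <;> exact sum_congr rfl fun m _ => by ring
    rw [h3] at h2
    linarith
  -- the computed endpoints
  have hS := SL_pos
  have hSr : (0 : ℝ) < SL := by exact_mod_cast hS
  unfold corrEncl
  constructor
  · -- lower endpoint
    have e1 := (MI.mem_ofFrac SL 1 (q := (b + 1) ^ 2) (by positivity)).1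
    have e2 := (MI.mem_ofFrac SL 1 (q := (a + 1) ^ 2) (by positivity)).2
    have f1 := Numerics.fdiv_le_div (a := (MI.ofFrac SL 1 ((b + 1) ^ 2)).lo) (b := 24) (by norm_num)
    have f2 := Numerics.div_le_cdiv (a := (MI.ofFrac SL 1 ((a + 1) ^ 2)).hi) (b := 24) (by norm_num)
    push_cast at e1 e2 f1 f2 ⊢
    have : (1 / ((b : ℝ) + 1) ^ 2 - 1 / ((a : ℝ) + 1) ^ 2) / 24 * SL ≤ (∑ m ∈ Ioc b a, corr m) * SL :=
      mul_le_mul_of_nonneg_right hL hSr.le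
    nlinarith
  · -- upper endpoint
    have e1 := (MI.mem_ofFrac SL 1 (q := b ^ 2) (pow_pos hb 2)).2
    have e2 := (MI.mem_ofFrac SL 1 (q := a ^ 2) (pow_pos (Nat.le_trans hb hab) 2)).1
    have e3 := (MI.mem_ofFrac SL 1 (q := b ^ 4) (pow_pos hb 4)).2
    have f1 := Numerics.div_le_cdiv (a := (MI.ofFrac SL 1 (b ^ 2)).hi) (b := 24) (by norm_num)
    have f2 := Numerics.fdiv_le_div (a := (MI.ofFrac SL 1 (a ^ 2)).lo) (b := 24) (by norm_num)
    have f3 := Numerics.div_le_cdiv (a := (MI.ofFrac SL 1 (b ^ 4)).hi) (b := 240) (by norm_num)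
    push_cast at e1 e2 e3 f1 f2 f3 ⊢
    have : (∑ m ∈ Ioc b a, corr m) * SL ≤
        ((1 / (b : ℝ) ^ 2 - 1 / (a : ℝ) ^ 2) / 24 + 1 / (b : ℝ) ^ 4 / 240) * SL :=
      mul_le_mul_of_nonneg_right hU hSr.le
    nlinarith

/-! ## The harmonic number by summation -/

/-- Invariant of `harmonicMI`. [folklore] -/
theorem harmonicMI_spec (W : ℕ) : ∀ (fuel m : ℕ) (acc : MI), 1 ≤ m → m ≤ W + 1 → W + 1 ≤ m + fuel →
    MI.mem SL (Hn (m - 1)) acc → MI.mem SL (Hn W) (harmonicMI W fuel m acc)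
  | 0, m, acc, hm, hmW, hf, hacc => by
    simp only [harmonicMI]
    have : m - 1 = W := by omega
    rw [← this]; exact hacc
  | fuel + 1, m, acc, hm, hmW, hf, hacc => by
    simp only [harmonicMI]
    split_ifs with h
    · refine harmonicMI_spec W fuel (m + 1) _ (by omega) (by omega) (by omega) ?_
      rw [Nat.add_sub_cancel, show m = (m - 1) + 1 by omega, Hn_succ, Nat.sub_add_cancel hm]
      refine MI.mem_add hacc ?_
      have := MI.mem_ofFrac SL 1 (q := m) (by omega)
      push_cast at this
      exact this
    · have : m - 1 = W := by omega
      rw [← this]; exact hacc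

/-- **`harmonicMI W W 1 0 ∋ H(W)`.** [folklore] -/
theorem mem_harmonicMI (W : ℕ) : MI.mem SL (Hn W) (harmonicMI W W 1 ⟨0, 0⟩) :=
  harmonicMI_spec W W 1 ⟨0, 0⟩ le_rfl (by omega) (by omega) (by simp [MI.mem])

/-! ## The chained table -/

/-- The guarantee on a table entry: `v ≤ 2^57 H(⌊N/idx⌋) < v + β + 1`. [folklore] -/
def HlogOK (N β v idx : ℕ) : Prop :=
  (v : ℝ) ≤ 2 ^ SH * Hn (N / idx) ∧ 2 ^ SH * Hn (N / idx) < v + β + 1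

/-- Rounding an enclosure at scale `2^90` of width `< β·2^33` with `lo ≥ 0` down to scale `2^57`.
[folklore] -/
theorem round_ok {x : ℝ} {I : MI} (hx : MI.mem SL x I) {β : ℕ} (hw : I.hi - I.lo < β * 2 ^ SI)
    (hlo : 0 ≤ I.lo) :
    ((I.lo.toNat >>> SI : ℕ) : ℝ) ≤ 2 ^ SH * x ∧ 2 ^ SH * x < (I.lo.toNat >>> SI : ℕ) + β + 1 := by
  rw [Nat.shiftRight_eq_div_pow]
  set L := I.lo.toNat with hL
  have hLlo : (L : ℤ) = I.lo := Int.toNat_of_nonneg hlo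
  have h1 : (I.lo : ℝ) ≤ x * SL := hx.1
  have h2 : x * SL ≤ (I.hi : ℝ) := hx.2
  have hSL : ((SL : ℕ) : ℝ) = 2 ^ SH * 2 ^ SI := by rw [SL, show (90 : ℕ) = SH + SI by rfl]; push_cast; ring
  have hLr : (I.lo : ℝ) = (L : ℝ) := by rw [← hLlo]; push_cast; ring
  rw [hLr] at h1
  have hw' : (I.hi : ℝ) < L + β * 2 ^ SI := by
    have : ((I.hi - I.lo : ℤ) : ℝ) < ((β * 2 ^ SI : ℕ) : ℝ) := by exact_mod_cast hw
    push_cast at this; linarith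
  have hq1 : ((L / 2 ^ SI : ℕ) : ℝ) * 2 ^ SI ≤ L := by exact_mod_cast Nat.div_mul_le_self _ _
  have hq2 : (L : ℝ) < (L / 2 ^ SI : ℕ) * 2 ^ SI + 2 ^ SI := by
    exact_mod_cast Nat.lt_div_mul_add (by positivity)
  have hpos : (0 : ℝ) < 2 ^ SI := by positivity
  rw [hSL] at h1 h2
  constructor
  · -- `q · 2^33 ≤ L ≤ x · 2^57 · 2^33`
    have : ((L / 2 ^ SI : ℕ) : ℝ) * 2 ^ SI ≤ 2 ^ SH * x * 2 ^ SI := by nlinarith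
    exact le_of_mul_le_mul_right this hpos
  · have : 2 ^ SH * x * 2 ^ SI < (((L / 2 ^ SI : ℕ) : ℝ) + β + 1) * 2 ^ SI := by nlinarith
    exact lt_of_mul_lt_mul_right this hpos.le

/-- **The chain is correct**: every entry it prepends satisfies `HlogOK` at its index. [folklore] -/
theorem hlogChain_spec (N β : ℕ) : ∀ (fuel e b : ℕ) (cur : MI) (l l' : List ℕ),
    hlogChain N β fuel e b cur l = some l' → 1 ≤ b → fuel ≤ e → MI.mem SL (Hn b) cur →
      ∃ vs : List ℕ, l' = vs ++ l ∧ vs.length = fuel ∧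
        ∀ i < fuel, ∃ v, vs[i]? = some v ∧ HlogOK N β v (e - fuel + 1 + i)
  | 0, e, b, cur, l, l', h, _, _, _ => by
    simp only [hlogChain, Option.some.injEq] at h
    exact ⟨[], by simp [h], rfl, fun i hi => absurd hi (Nat.not_lt_zero i)⟩
  | fuel + 1, e, b, cur, l, l', h, hb, hfe, hcur => by
    simp only [hlogChain] at h
    split at h
    · exact absurd h (by simp)
    · rename_i L hL
      split_ifs at h with hc
      push Not at hc
      obtain ⟨hba, _⟩ := logRatio_some_iff_le hL
      set a := N / e with ha
      set cur' := (cur.add L).sub (corrEncl a b) with hcur'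
      have hmem : MI.mem SL (Hn a) cur' := by
        have e1 : Hn a = Hn b + Real.log ((2 * a + 1) / (2 * b + 1)) - ∑ m ∈ Ioc b a, corr m := by
          have := Hn_eq_log_sub_corr hba; linarith
        rw [e1]
        exact MI.mem_sub (MI.mem_add hcur (mem_logRatio hL)) (mem_corrEncl hba hb)
      have hok : HlogOK N β (cur'.lo.toNat >>> SI) e := round_ok hmem hc.1 hc.2
      obtain ⟨vs, hvs, hlen, hall⟩ := hlogChain_spec N β fuel (e - 1) a cur' _ l' h
        (hb.trans hba) (by omega) hmem
      refine ⟨vs ++ [cur'.lo.toNat >>> SI], by rw [hvs]; simp, by simp [hlen], fun i hi => ?_⟩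
      rcases Nat.lt_succ_iff_lt_or_eq.1 hi with hi' | heq
      · obtain ⟨v, hv, hvok⟩ := hall i hi'
        refine ⟨v, by rw [List.getElem?_append_left (by rw [hlen]; exact hi'), hv], ?_⟩
        rw [show e - (fuel + 1) + 1 + i = e - 1 - fuel + 1 + i by omega]
        exact hvok
      · subst heq
        refine ⟨cur'.lo.toNat >>> SI, ?_, ?_⟩
        · rw [List.getElem?_append_right (by rw [hlen]), hlen, Nat.sub_self]; rfl
        · rw [show e - (i + 1) + 1 + i = e by omega]; exact hok

/-- **The table `hlogTab p eLo eHi`**: size `eHi + 1`, and for `eLo < idx ≤ eHi` the entry satisfies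
`hl[idx] ≤ 2^57 H(⌊N/idx⌋) < hl[idx] + β + 1`. [folklore] -/
theorem hlogTab_spec (p : Params) {eLo eHi : ℕ} {hl : Array ℕ} (h : hlogTab p eLo eHi = some hl) :
    hl.size = eHi + 1 ∧ ∀ idx, eLo < idx → idx ≤ eHi →
      ∃ v, hl[idx]? = some v ∧ HlogOK p.N p.beta v idx := by
  unfold hlogTab at h
  simp only at h
  split_ifs at h with hc
  push Not at hc
  split at h
  · exact absurd h (by simp)
  · rename_i l hl'
    simp only [Option.some.injEq] at h
    subst h
    have hb0 : 1 ≤ p.N / (eHi + 1) := Nat.one_le_iff_ne_zero.2 hc.1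
    obtain ⟨vs, hvs, hlen, hall⟩ := hlogChain_spec p.N p.beta (eHi - eLo) eHi (p.N / (eHi + 1))
      _ [] l hl' hb0 (Nat.sub_le _ _) (mem_harmonicMI _)
    rw [List.append_nil] at hvs
    subst hvs
    refine ⟨by simp [hlen]; omega, fun idx h1 h2 => ?_⟩
    obtain ⟨v, hv, hok⟩ := hall (idx - (eLo + 1)) (by omega)
    refine ⟨v, ?_, ?_⟩
    · rw [List.getElem?_toArray, List.getElem?_append_right (by simp; omega), List.length_replicate, hv]
    · rw [show eHi - (eHi - eLo) + 1 + (idx - (eLo + 1)) = idx by omega] at hok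
      exact hok

end Literature.Barriers.RiemannHypothesis.TuranMinWitness
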